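import Literature.NumberTheory.NumberFields.IdealGroupFirstCohomology
import Literature.NumberTheory.NumberFields.HilbertTheorem94
import HarnessLib

/-!
# Chevalley's ambiguous class number formula, I: the index form
# `#Cl(L)^G · [L:K] · [E_K : E_K ∩ N Lˣ] = e_∞ · [𝓘_L^G : ιP_K]`

Topic `NumberTheory/NumberFields`; namespace `Literature.NumberTheory.NumberFields.AmbiguousClass`.
Theorem-only file (no definition, no named fact).  For a cyclic extension `L/K` of number fields
with `G = Gal(L/K) = ⟨σ⟩`, S. Lang, *Cyclotomic Fields I and II*, Ch. 13 §4 proves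

> **Lemma 4.1.** `|C_K^G| = h(F) e(K/F) / ([K:F] (E_F : N_{K/F}K^* ∩ E_F))`, `e(K/F) = ∏_v e(v)`

through four index identities (loc. cit., PDF pp. 203–204): (1) `|C^G| = (I^G : P^G) |H¹(P)|`
(from `H¹(G, I) = 0`), (2) `(I^G : P^G) = e₀ h_F / (P^G : P_F)`, (3) `(P^G : P_F) = |H¹(E)|`
(Hilbert 90), (4) `|H¹(P)| = (N K^* ∩ E_F : N E_K)`, and the Herbrand quotient of the units.
This file proves (1), (3), (4) and assembles them with the units' Herbrand quotient
(`MinkowskiUnit.card_mul_h0_unitsE_eq`, Childress Prop. 5.10) into the **index form**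

  **`#Cl(L)^G · [L : K] · [E_K : E_K ∩ N_{L/K} Lˣ] = e_∞ · [𝓘_L^G : ιP_K]`**

(`card_fixed_mul_finrank_mul_relIndex_eq`); the sequel `AmbiguousClassNumberFormula.lean` inserts
(2), `[𝓘_L^G : ιP_K] = h_K · ∏_𝔭 e_𝔭` (`AmbiguousIdeals.lean`), giving Lemma 4.1.  Everything lives
in the ambient groups `Lˣ` and `𝓘_L = (FractionalIdeal (𝓞 L)⁰ L)ˣ` of the tree's index calculus
(`CyclicHerbrandQuotient.lean`, `AmbiguousClassGaloisAction.lean`): `#Cl(L)^G` is the number of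
Galois-fixed classes (`card_fixed_eq_relIndex`), `E_K = 𝓞_Lˣ ∩ Kˣ`, `N_{L/K} Lˣ = N_G(Lˣ)`
(`Herbrand.norm`), `𝓘_L^G = z0 σ ⊤ ⊥`, `ιP_K` the principal ideals extended from `K`, and
`e_∞ = ArchHerbrand.archFactor K L` (`= 2^{#real places of K complexified in L}`).

* (1) `relIndex_sup_z0_eq_h1_principals`, `card_fixed_eq_relIndex_mul_h1` —
  `#C^G = [I^G : P^G] · #H¹(G, P_L)`, the connecting map realised by
  `σ − 1 : {I : σI/I ∈ P} → {p ∈ P : N p = 1}` and **`H¹(G, 𝓘_L) = 0`**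
  (`IdealGroupFirstCohomology.lean`);
* (3) `relIndex_map_principals_z0_eq_h1` — `[P^G : ιP_K] = #H¹(G, E_L)`
  (`HilbertTheorem94.relIndex_z0_unitsE_eq_h1`, no ramification hypothesis);
* (4) `h1_principals_eq_relIndex` — `#H¹(G, P_L) = [E_K ∩ N Lˣ : N E_L]` (the norm map);
* `h0_unitsE_eq_relIndex_mul` — `#Ĥ⁰(G, E_L) = [E_K ∩ N Lˣ : N E_L] · [E_K : E_K ∩ N Lˣ]`;
* `relIndex_map_principals_z0_top_eq` — `[𝓘_L^G : ιP_K] = #H¹(G, E_L) · [𝓘_L^G : P_L^G]`;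
* **`card_fixed_mul_finrank_mul_relIndex_eq`** — the index form above; `relIndex_unitsNorm_ne_zero`;
  `index_principals_eq_classNumber` (`[𝓘_K : P_K] = h_K`).

## References

* S. Lang, *Cyclotomic Fields I and II*, GTM 121 (1990), Ch. 13 §4, Lemma 4.1 with proof
  (held copy, PDF pp. 203–204). [Lang1990]
* C. Chevalley, *Sur la théorie du corps de classes dans les corps finis et les corps locaux*,
  J. Fac. Sci. Tokyo 2 (1933) 365–476.
* G. Gras, *Class Field Theory* (2003), II.6.2.3. [Gras2003]
* N. Childress, *Class Field Theory* (2009), Ch. 4 §5 Prop. 5.10. [Childress2009]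
-/

noncomputable section

open NumberField IsDedekindDomain FractionalIdeal
open scoped nonZeroDivisors Pointwise

namespace Literature.NumberTheory.NumberFields.AmbiguousClass

open Literature.NumberTheory.GaloisRepresentations Literature.NumberTheory.GaloisRepresentations.Herbrand
  Literature.NumberTheory.GaloisRepresentations.MinkowskiUnit
  Literature.NumberTheory.GaloisRepresentations.CyclicNormIndex
  Literature.NumberTheory.NumberFields.AmbiguousIdeal

/-! ### Index bookkeeping -/

section Group

variable {G H : Type*} [Group G] [Group H]

/-- If `B ≤ A` and `ker f ∩ A ≤ B` then `[f(A) : f(B)] = [A : B]` (a copy of the private lemma of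
`HilbertTheorem94.lean`). [folklore] -/
private theorem relIndex_map_map_of_ker_inf_le (f : G →* H) {A B : Subgroup G} (hBA : B ≤ A)
    (hker : f.ker ⊓ A ≤ B) : (B.map f).relIndex (A.map f) = B.relIndex A := by
  have hX : (B.map f).comap f ⊓ A = B ⊓ A := by
    ext x
    simp only [Subgroup.mem_inf, Subgroup.mem_comap, Subgroup.mem_map]
    constructor
    · rintro ⟨⟨b, hb, hbx⟩, hxA⟩
      have hk : x * b⁻¹ ∈ f.ker ⊓ A :=
        Subgroup.mem_inf.mpr ⟨by rw [MonoidHom.mem_ker, map_mul, map_inv, ← hbx, mul_inv_cancel],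
          A.mul_mem hxA (A.inv_mem (hBA hb))⟩
      have := B.mul_mem (hker hk) hb
      rw [inv_mul_cancel_right] at this
      exact ⟨this, hxA⟩
    · rintro ⟨hxB, hxA⟩
      exact ⟨⟨x, hxB, rfl⟩, hxA⟩
  rw [← Subgroup.relIndex_comap, ← Subgroup.inf_relIndex_right ((B.map f).comap f), hX,
    Subgroup.inf_relIndex_right]

end Group

variable {K L : Type} [Field K] [NumberField K] [Field L] [NumberField L] [Algebra K L]

variable (K) in
/-- **`[𝓘_K : P_K] = h_K`**: the index of the principal fractional ideals in the invertible ones is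
the class number. [cite: NeukirchANT1999, Ch. I §3 (exact sequence after Cor. (3.9), p. 22)] -/
theorem index_principals_eq_classNumber : (principals K).index = classNumber K := by
  have hsurj : Function.Surjective (ClassGroup.mk K : (FractionalIdeal (𝓞 K)⁰ K)ˣ →* _) :=
    fun c => ClassGroup.induction K (fun I => ⟨I, rfl⟩) c
  have hkerK : (ClassGroup.mk K : (FractionalIdeal (𝓞 K)⁰ K)ˣ →* _).ker = principals K := by
    ext I
    rw [MonoidHom.mem_ker, ← (ClassGroup.mk K).map_one, mk_eq_mk_iff, mul_one, inv_mem_iff]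
  rw [← hkerK, Subgroup.index_ker, MonoidHom.range_eq_top.mpr hsurj, Subgroup.card_top,
    classNumber, Nat.card_eq_fintype_card]

/-- `N_G = N` on `Lˣ`: the tree's `normEnd σ #G` is `Herbrand.norm G` when `σ` generates `G`.
[folklore] -/
private theorem normEnd_card_eq_norm {σ : L ≃ₐ[K] L} (hσ : ∀ τ : L ≃ₐ[K] L, τ ∈ Subgroup.zpowers σ)
    (a : Lˣ) : normEnd σ (Nat.card (L ≃ₐ[K] L)) a = Herbrand.norm (L ≃ₐ[K] L) a := by
  rw [normEnd_apply, prod_range_card_pow_eq_prod hσ (fun g => g • a), ← norm_apply]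

/-! ### The ambiguous principal ideals `P_L^G` -/

omit [NumberField K] in
/-- `P_L^G = P_L ∩ 𝓘_L^G` (`z0 σ P ⊥ = P ⊓ z0 σ ⊤ ⊥`): the ambiguous principal ideals of the
inclusions `I_K^G ⊃ P_K^G ⊃ P_F`. [cite: Lang1990, Ch. 13 §4, proof of Lemma 4.1, eq. (2) (PDF p. 203)] -/
theorem z0_principals_bot_eq_inf (σ : L ≃ₐ[K] L) :
    z0 σ (principals L) ⊥ = principals L ⊓ z0 σ (⊤ : Subgroup (FractionalIdeal (𝓞 L)⁰ L)ˣ) ⊥ := by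
  ext I
  rw [mem_z0_bot, Subgroup.mem_inf, mem_z0_bot]
  simp only [Subgroup.mem_top, true_and]

omit [NumberField K] in
/-- **`P_L^G = π{a ∈ Lˣ : σa/a ∈ 𝓞_Lˣ}`**: a principal ideal `(a)` is `σ`-invariant iff `σa/a` is
a unit (`π : a ↦ (a)` has kernel `𝓞_Lˣ`). [cite: Lang1990, Ch. 13 §4, proof of Lemma 4.1 (PDF p. 204)] -/
theorem z0_principals_bot_eq_map (σ : L ≃ₐ[K] L) :
    z0 σ (principals L) ⊥ = (z0 σ ⊤ (unitsE L)).map (toPrincipalIdeal (𝓞 L) L) := by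
  have hπ : ∀ (g : L ≃ₐ[K] L) (a : Lˣ),
      toPrincipalIdeal (𝓞 L) L (g • a) = g • toPrincipalIdeal (𝓞 L) L a := toPrincipalIdeal_smul
  have h := z0_map_eq (σ := σ) (A := ⊤) (C := unitsE L) (toPrincipalIdeal (𝓞 L) L) hπ
    IsStable.top le_top (by rw [ker_toPrincipalIdeal_eq_unitsE]; exact inf_le_right)
  rw [← MonoidHom.range_eq_map, (Subgroup.map_eq_bot_iff _).mpr
    (by rw [ker_toPrincipalIdeal_eq_unitsE])] at h
  exact h

/-- `ιP_K ≤ P_L^G`: principal ideals extended from `K` are ambiguous principal ideals.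
[cite: Lang1990, Ch. 13 §4, proof of Lemma 4.1 (PDF p. 203)] -/
theorem map_principals_le_z0_principals (σ : L ≃ₐ[K] L) :
    (principals K).map (Units.map (extendedHom L (𝓞 L) :
        FractionalIdeal (𝓞 K)⁰ K →+* FractionalIdeal (𝓞 L)⁰ L).toMonoidHom) ≤
      z0 σ (principals L) ⊥ := by
  rw [map_extendedHom_principals_eq, z0_principals_bot_eq_map]
  refine Subgroup.map_mono ?_
  rintro _ ⟨k, rfl⟩
  refine mem_z0.mpr ⟨Subgroup.mem_top _, ?_⟩
  rw [smul_unitsIncl, div_self']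
  exact (unitsE L).one_mem

/-- **(3) `[P_L^G : ιP_K] = #H¹(G, 𝓞_Lˣ)`** for `L/K` cyclic with `Gal(L/K) = ⟨σ⟩`
(`0 → E_F → F^* → P_K^G → H¹(E_K) → 0` by Hilbert's Theorem 90), in index form: the chain
`[π{a : σa/a ∈ E} : πKˣ] = [{a : σa/a ∈ E} : Kˣ E] = #Ĥ⁻¹(G, E)`
(`HilbertTheorem94.relIndex_z0_unitsE_eq_h1`); no ramification hypothesis.
[cite: Lang1990, Ch. 13 §4, proof of Lemma 4.1, eq. (3) (PDF p. 204)] -/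
theorem relIndex_map_principals_z0_eq_h1 [IsGalois K L] {σ : L ≃ₐ[K] L}
    (hσ : ∀ τ : L ≃ₐ[K] L, τ ∈ Subgroup.zpowers σ) :
    ((principals K).map (Units.map (extendedHom L (𝓞 L) :
        FractionalIdeal (𝓞 K)⁰ K →+* FractionalIdeal (𝓞 L)⁰ L).toMonoidHom)).relIndex
        (z0 σ (principals L) ⊥) = h1 σ (unitsE L) ⊥ := by
  have hEle : unitsE L ≤ z0 σ ⊤ (unitsE L) := fun e he =>
    mem_z0.mpr ⟨Subgroup.mem_top e, (unitsE L).div_mem (isStable_unitsE σ he) he⟩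
  have hKle : (unitsIncl K L).range ≤ z0 σ ⊤ (unitsE L) := by
    rintro _ ⟨k, rfl⟩
    refine mem_z0.mpr ⟨Subgroup.mem_top _, ?_⟩
    rw [smul_unitsIncl, div_self']
    exact (unitsE L).one_mem
  have hle : unitsE L ⊔ (unitsIncl K L).range ≤ z0 σ ⊤ (unitsE L) := sup_le hEle hKle
  have hkerle : (toPrincipalIdeal (𝓞 L) L).ker ⊓ z0 σ ⊤ (unitsE L) ≤
      unitsE L ⊔ (unitsIncl K L).range := by
    rw [ker_toPrincipalIdeal_eq_unitsE]; exact inf_le_left.trans le_sup_left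
  rw [map_extendedHom_principals_eq, z0_principals_bot_eq_map, ← relIndex_z0_unitsE_eq_h1 hσ,
    ← relIndex_map_map_of_ker_inf_le _ hle hkerle, Subgroup.map_sup,
    ← ker_toPrincipalIdeal_eq_unitsE, (Subgroup.map_eq_bot_iff _).mpr le_rfl, bot_sup_eq]

/-! ### (1) `#C^G = [I^G : P^G] · #H¹(G, P_L)` -/

/-- **The connecting homomorphism `C_L^G → H¹(G, P_L)` in index form**: for `Aut(L/K) = ⟨σ⟩`,
`[{I : σI/I ∈ P} : 𝓘_L^G · P] = #Ĥ⁻¹(G, P_L)`.  The map `σ − 1` sends `{I : σI/I ∈ P}` onto the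
principal ideals of norm `1` — every such one is `σJ/J` since **`H¹(G, 𝓘_L) = 0`**
(`AmbiguousIdeal.exists_smul_div_eq_of_norm_eq_one`) — with kernel `𝓘_L^G`, and `𝓘_L^G · P` onto
`(σ − 1)P`. [cite: Lang1990, Ch. 13 §4, proof of Lemma 4.1, eq. (1) (PDF pp. 203–204)] -/
theorem relIndex_sup_z0_eq_h1_principals {σ : L ≃ₐ[K] L}
    (hσ : ∀ τ : L ≃ₐ[K] L, τ ∈ Subgroup.zpowers σ) :
    (z0 σ (⊤ : Subgroup (FractionalIdeal (𝓞 L)⁰ L)ˣ) ⊥ ⊔ principals L).relIndex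
        (z0 σ ⊤ (principals L)) = h1 σ (principals L) ⊥ := by
  have hPZ : principals L ≤ z0 σ ⊤ (principals L) := fun p hp =>
    mem_z0.mpr ⟨Subgroup.mem_top p, (principals L).div_mem (isStable_principals σ hp) hp⟩
  have hIGZ : z0 σ (⊤ : Subgroup (FractionalIdeal (𝓞 L)⁰ L)ˣ) ⊥ ≤ z0 σ ⊤ (principals L) :=
    z0_mono bot_le
  have hle : z0 σ (⊤ : Subgroup (FractionalIdeal (𝓞 L)⁰ L)ˣ) ⊥ ⊔ principals L ≤
      z0 σ ⊤ (principals L) := sup_le hIGZ hPZ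
  have hker : (twist σ : (FractionalIdeal (𝓞 L)⁰ L)ˣ →* _).ker ⊓ z0 σ ⊤ (principals L) ≤
      z0 σ (⊤ : Subgroup (FractionalIdeal (𝓞 L)⁰ L)ˣ) ⊥ ⊔ principals L := by
    intro I hI
    obtain ⟨hI1, -⟩ := Subgroup.mem_inf.mp hI
    rw [MonoidHom.mem_ker, twist_eq_one_iff] at hI1
    exact Subgroup.mem_sup_left (mem_z0_bot.mpr ⟨Subgroup.mem_top I, hI1⟩)
  rw [← relIndex_map_map_of_ker_inf_le (twist σ) hle hker]
  have h1 : (z0 σ (⊤ : Subgroup (FractionalIdeal (𝓞 L)⁰ L)ˣ) ⊥ ⊔ principals L).map (twist σ) =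
      b1 σ (principals L) ⊥ := by
    rw [Subgroup.map_sup, b1_bot, (Subgroup.map_eq_bot_iff _).mpr ?_, bot_sup_eq]
    intro I hI
    rw [MonoidHom.mem_ker, twist_eq_one_iff]
    exact (mem_z0_bot.mp hI).2
  have h2 : (z0 σ ⊤ (principals L)).map (twist σ) = z1 (L ≃ₐ[K] L) (principals L) ⊥ := by
    apply le_antisymm
    · rintro _ ⟨I, hI, rfl⟩
      exact mem_z1_bot.mpr ⟨(mem_z0.mp hI).2, norm_twist σ I⟩
    · intro p hp
      obtain ⟨hpP, hN⟩ := mem_z1_bot.mp hp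
      obtain ⟨J, hJ⟩ := exists_smul_div_eq_of_norm_eq_one hσ hN
      refine ⟨J, mem_z0.mpr ⟨Subgroup.mem_top J, ?_⟩, hJ⟩
      rw [hJ]
      exact hpP
  rw [h1, h2, h1_def]

/-- **(1) `#Cl(L)^G = [𝓘_L^G : P_L^G] · #H¹(G, P_L)`** for `Aut(L/K) = ⟨σ⟩` cyclic: the exact
sequence `0 → I_K^G/P_K^G → C_K^G → H¹(G, P_K) → 0` (from `H¹(G, I_K) = 0`) in index form,
`[𝓘_L^G : P_L^G]` being written `[𝓘_L^G : P_L ∩ 𝓘_L^G] = (principals L).relIndex (z0 σ ⊤ ⊥)`.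
[cite: Lang1990, Ch. 13 §4, proof of Lemma 4.1, eq. (1) (PDF p. 204)] -/
theorem card_fixed_eq_relIndex_mul_h1 {σ : L ≃ₐ[K] L}
    (hσ : ∀ τ : L ≃ₐ[K] L, τ ∈ Subgroup.zpowers σ) :
    Nat.card {c : ClassGroup (𝓞 L) // ∀ τ : L ≃ₐ[K] L, ClassGroup.mulEquiv (intAut τ) c = c} =
      (principals L).relIndex (z0 σ (⊤ : Subgroup (FractionalIdeal (𝓞 L)⁰ L)ˣ) ⊥) *
        h1 σ (principals L) ⊥ := by
  have hPZ : principals L ≤ z0 σ ⊤ (principals L) := fun p hp =>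
    mem_z0.mpr ⟨Subgroup.mem_top p, (principals L).div_mem (isStable_principals σ hp) hp⟩
  have hIGZ : z0 σ (⊤ : Subgroup (FractionalIdeal (𝓞 L)⁰ L)ˣ) ⊥ ≤ z0 σ ⊤ (principals L) :=
    z0_mono bot_le
  have hmul := Subgroup.relIndex_mul_relIndex (principals L)
    (z0 σ (⊤ : Subgroup (FractionalIdeal (𝓞 L)⁰ L)ˣ) ⊥ ⊔ principals L) (z0 σ ⊤ (principals L))
    le_sup_right (sup_le hIGZ hPZ)
  rw [card_fixed_eq_relIndex hσ, ← hmul, relIndex_sup_z0_eq_h1_principals hσ,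
    Subgroup.relIndex_sup_right]

/-! ### `[𝓘_L^G : ιP_K] = #H¹(G, E_L) · [𝓘_L^G : P_L^G]` -/

/-- **`[𝓘_L^G : ιP_K] = #H¹(G, 𝓞_Lˣ) · [𝓘_L^G : P_L^G]`** for `L/K` Galois with cyclic group `⟨σ⟩`:
the chain `ιP_K ≤ P_L^G ≤ 𝓘_L^G` with (3) `[P_L^G : ιP_K] = #H¹(G, E_L)`; here `[𝓘_L^G : P_L^G]` is
written `[𝓘_L^G : P_L ∩ 𝓘_L^G] = (principals L).relIndex (z0 σ ⊤ ⊥)`.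
[cite: Lang1990, Ch. 13 §4, proof of Lemma 4.1, eq. (2)–(3) (PDF pp. 203–204)] -/
theorem relIndex_map_principals_z0_top_eq [IsGalois K L] {σ : L ≃ₐ[K] L}
    (hσ : ∀ τ : L ≃ₐ[K] L, τ ∈ Subgroup.zpowers σ) :
    ((principals K).map (Units.map (extendedHom L (𝓞 L) :
        FractionalIdeal (𝓞 K)⁰ K →+* FractionalIdeal (𝓞 L)⁰ L).toMonoidHom)).relIndex
        (z0 σ (⊤ : Subgroup (FractionalIdeal (𝓞 L)⁰ L)ˣ) ⊥) =
      h1 σ (unitsE L) ⊥ *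
        (principals L).relIndex (z0 σ (⊤ : Subgroup (FractionalIdeal (𝓞 L)⁰ L)ˣ) ⊥) := by
  have h₁ : (principals K).map (Units.map (extendedHom L (𝓞 L) :
      FractionalIdeal (𝓞 K)⁰ K →+* FractionalIdeal (𝓞 L)⁰ L).toMonoidHom) ≤ z0 σ (principals L) ⊥ :=
    map_principals_le_z0_principals σ
  have h₂ : z0 σ (principals L) ⊥ ≤ z0 σ (⊤ : Subgroup (FractionalIdeal (𝓞 L)⁰ L)ˣ) ⊥ := by
    rw [z0_principals_bot_eq_inf]; exact inf_le_right
  rw [← Subgroup.relIndex_mul_relIndex _ _ _ h₁ h₂, relIndex_map_principals_z0_eq_h1 hσ,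
    z0_principals_bot_eq_inf, Subgroup.inf_relIndex_right]

/-! ### (4) `#H¹(G, P_L) = [E_K ∩ N Lˣ : N E_L]` -/

/-- **(4) `#H¹(G, P_L) = [E ∩ N_G Lˣ : N_G E]`** (`E = 𝓞_Lˣ`) for `L/K` Galois with cyclic
group `⟨σ⟩`: `0 = H¹(K^*) → H¹(P_K) → H⁰(E_K) → H⁰(K^*)` — in index form, `P_L ≅ Lˣ/E` so
`#H¹(G, P_L) = [{a : N a ∈ E} : E·(σ − 1)Lˣ]`, and the norm map takes this pair onto
`N E ≤ E ∩ N Lˣ` with kernel `{N = 1} = (σ − 1)Lˣ` (Hilbert's Theorem 90).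
[cite: Lang1990, Ch. 13 §4, proof of Lemma 4.1, eq. (4) (PDF p. 204)] -/
theorem h1_principals_eq_relIndex [IsGalois K L] {σ : L ≃ₐ[K] L}
    (hσ : ∀ τ : L ≃ₐ[K] L, τ ∈ Subgroup.zpowers σ) :
    h1 σ (principals L) ⊥ =
      ((unitsE L).map (Herbrand.norm (L ≃ₐ[K] L))).relIndex
        (unitsE L ⊓ (⊤ : Subgroup Lˣ).map (Herbrand.norm (L ≃ₐ[K] L))) := by
  -- (a) `h1(P_L) = h1(Lˣ/E)` along `π : a ↦ (a)`
  have hπ : ∀ (g : L ≃ₐ[K] L) (a : Lˣ),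
      toPrincipalIdeal (𝓞 L) L (g • a) = g • toPrincipalIdeal (𝓞 L) L a := toPrincipalIdeal_smul
  have ha : h1 σ (principals L) ⊥ = h1 σ (⊤ : Subgroup Lˣ) (unitsE L) := by
    have h := h1_map_eq (σ := σ) (toPrincipalIdeal (𝓞 L) L) hπ IsStable.top isStable_unitsE le_top
      (by rw [ker_toPrincipalIdeal_eq_unitsE]; exact inf_le_right)
    rw [← MonoidHom.range_eq_map, (Subgroup.map_eq_bot_iff _).mpr
      (by rw [ker_toPrincipalIdeal_eq_unitsE])] at h
    exact h
  rw [ha, h1_def]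
  -- (b) apply the norm map
  set N : Lˣ →* Lˣ := Herbrand.norm (L ≃ₐ[K] L) with hN
  have hBA : b1 σ (⊤ : Subgroup Lˣ) (unitsE L) ≤ z1 (L ≃ₐ[K] L) ⊤ (unitsE L) :=
    b1_le_z1 IsStable.top isStable_unitsE le_top
  have hker : N.ker ⊓ z1 (L ≃ₐ[K] L) ⊤ (unitsE L) ≤ b1 σ ⊤ (unitsE L) := by
    intro a ha
    obtain ⟨ha1, -⟩ := Subgroup.mem_inf.mp ha
    rw [MonoidHom.mem_ker, hN] at ha1
    obtain ⟨b, hb⟩ := exists_smul_div_eq_of_normEnd_eq_one hσ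
      (show normEnd σ (Nat.card (L ≃ₐ[K] L)) a = 1 by rw [normEnd_card_eq_norm hσ, ha1])
    exact mem_b1.mpr ⟨1, (unitsE L).one_mem, b, Subgroup.mem_top b, by rw [one_mul]; exact hb⟩
  rw [← relIndex_map_map_of_ker_inf_le N hBA hker]
  have h1 : (z1 (L ≃ₐ[K] L) ⊤ (unitsE L)).map N = unitsE L ⊓ (⊤ : Subgroup Lˣ).map N := by
    ext x
    constructor
    · rintro ⟨a, ha', rfl⟩
      exact ⟨(mem_z1.mp ha').2, ⟨a, Subgroup.mem_top a, rfl⟩⟩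
    · rintro ⟨hxE, ⟨a, -, rfl⟩⟩
      exact ⟨a, mem_z1.mpr ⟨Subgroup.mem_top a, hxE⟩, rfl⟩
  have h2 : (b1 σ (⊤ : Subgroup Lˣ) (unitsE L)).map N = (unitsE L).map N := by
    apply le_antisymm
    · rintro _ ⟨x, hx, rfl⟩
      obtain ⟨c, hc, a', -, rfl⟩ := mem_b1.mp hx
      refine ⟨c, hc, ?_⟩
      rw [map_mul, hN, norm_twist, mul_one]
    · exact Subgroup.map_mono le_b1
  rw [h1, h2]

/-! ### The unit indices -/

/-- `N_G(Lˣ) ≤ Kˣ`: norms are fixed by the Galois group, hence lie in `K` (`L/K` Galois,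
`Gal = ⟨σ⟩`; `N_G a = ∏_i σ^i a = N_{L|K}(a)`). [cite: NeukirchANT1999, Ch. IV §7 (p. 310)] -/
theorem map_norm_top_le_range_unitsIncl [IsGalois K L] {σ : L ≃ₐ[K] L}
    (hσ : ∀ τ : L ≃ₐ[K] L, τ ∈ Subgroup.zpowers σ) :
    (⊤ : Subgroup Lˣ).map (Herbrand.norm (L ≃ₐ[K] L)) ≤ (unitsIncl K L).range := by
  rintro _ ⟨a, -, rfl⟩
  rw [← ker_twistEnd hσ, MonoidHom.mem_ker, twistEnd_apply, smul_norm, div_self']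

/-- `N_G(E) ≤ E ∩ N_G(Lˣ) ≤ E ∩ Kˣ` (`E = 𝓞_Lˣ`): the inclusions
`E_F ⊃ (N_{K/F}K^* ∩ E_F) ⊃ N_{K/F}E_K` of Lang's proof. [cite: Lang1990, Ch. 13 §4, proof of Lemma 4.1 (PDF p. 204)] -/
theorem map_norm_unitsE_le [IsGalois K L] {σ : L ≃ₐ[K] L}
    (hσ : ∀ τ : L ≃ₐ[K] L, τ ∈ Subgroup.zpowers σ) :
    (unitsE L).map (Herbrand.norm (L ≃ₐ[K] L)) ≤
        unitsE L ⊓ (⊤ : Subgroup Lˣ).map (Herbrand.norm (L ≃ₐ[K] L)) ∧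
      unitsE L ⊓ (⊤ : Subgroup Lˣ).map (Herbrand.norm (L ≃ₐ[K] L)) ≤
        unitsE L ⊓ (unitsIncl K L).range := by
  refine ⟨?_, inf_le_inf_left _ (map_norm_top_le_range_unitsIncl hσ)⟩
  rintro _ ⟨e, he, rfl⟩
  exact ⟨isStable_unitsE.norm_mem he, ⟨e, Subgroup.mem_top e, rfl⟩⟩

/-- **`#Ĥ⁰(G, 𝓞_Lˣ) = [E_K ∩ N Lˣ : N E_L] · [E_K : E_K ∩ N Lˣ]`** (`E_K = 𝓞_Lˣ ∩ Kˣ`, the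
inclusions `E_F ⊃ (N_{K/F}K^* ∩ E_F) ⊃ N_{K/F}E_K` of Lang's proof). [cite: Lang1990, Ch. 13 §4, proof of Lemma 4.1 (PDF p. 204)] -/
theorem h0_unitsE_eq_relIndex_mul [IsGalois K L] {σ : L ≃ₐ[K] L}
    (hσ : ∀ τ : L ≃ₐ[K] L, τ ∈ Subgroup.zpowers σ) :
    h0 σ (unitsE L) ⊥ =
      ((unitsE L).map (Herbrand.norm (L ≃ₐ[K] L))).relIndex
          (unitsE L ⊓ (⊤ : Subgroup Lˣ).map (Herbrand.norm (L ≃ₐ[K] L))) *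
        (unitsE L ⊓ (⊤ : Subgroup Lˣ).map (Herbrand.norm (L ≃ₐ[K] L))).relIndex
          (unitsE L ⊓ (unitsIncl K L).range) := by
  obtain ⟨h₁, h₂⟩ := map_norm_unitsE_le hσ
  rw [h0_unitsE_eq_relIndex hσ, Subgroup.relIndex_mul_relIndex _ _ _ h₁ h₂]

/-! ### Chevalley's formula, index form -/

/-- **CHEVALLEY'S AMBIGUOUS CLASS NUMBER FORMULA, index form.**  Let `L/K` be a cyclic extension of
number fields with `G = Gal(L/K) = ⟨σ⟩`.  Then

  `#Cl(L)^G · [L : K] · [E_K : E_K ∩ N_{L/K} Lˣ] = e_∞ · [𝓘_L^G : ιP_K]`,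

where `#Cl(L)^G` is the number of ideal classes of `L` fixed by `G`, `E_K = 𝓞_Lˣ ∩ Kˣ`,
`N_{L/K} Lˣ = N_G(Lˣ)`, `e_∞ = ArchHerbrand.archFactor K L` and `[𝓘_L^G : ιP_K]` is the index of the
principal ideals extended from `K` in the ambiguous ideals (`= h_K · ∏_𝔭 e_𝔭`, inserted in
`AmbiguousClassNumberFormula.lean`).  Assembly of (1), (3), (4) and
`[L:K] · #Ĥ⁰(G, E_L) = e_∞ · #Ĥ⁻¹(G, E_L)` (`MinkowskiUnit.card_mul_h0_unitsE_eq`).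
[cite: Lang1990, Ch. 13 §4, Lemma 4.1, proof (PDF pp. 203–204)] [cite: Gras2003, II.6.2.3] -/
theorem card_fixed_mul_finrank_mul_relIndex_eq [IsGalois K L] {σ : L ≃ₐ[K] L}
    (hσ : ∀ τ : L ≃ₐ[K] L, τ ∈ Subgroup.zpowers σ) :
    Nat.card {c : ClassGroup (𝓞 L) // ∀ τ : L ≃ₐ[K] L, ClassGroup.mulEquiv (intAut τ) c = c} *
        Module.finrank K L *
        (unitsE L ⊓ (⊤ : Subgroup Lˣ).map (Herbrand.norm (L ≃ₐ[K] L))).relIndex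
          (unitsE L ⊓ (unitsIncl K L).range) =
      ArchHerbrand.archFactor K L *
        ((principals K).map (Units.map (extendedHom L (𝓞 L) :
            FractionalIdeal (𝓞 K)⁰ K →+* FractionalIdeal (𝓞 L)⁰ L).toMonoidHom)).relIndex
          (z0 σ (⊤ : Subgroup (FractionalIdeal (𝓞 L)⁰ L)ˣ) ⊥) := by
  set c := Nat.card {c : ClassGroup (𝓞 L) // ∀ τ : L ≃ₐ[K] L, ClassGroup.mulEquiv (intAut τ) c = c}
    with hc
  set x := (principals L).relIndex (z0 σ (⊤ : Subgroup (FractionalIdeal (𝓞 L)⁰ L)ˣ) ⊥) with hx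
  set y := ((unitsE L).map (Herbrand.norm (L ≃ₐ[K] L))).relIndex
      (unitsE L ⊓ (⊤ : Subgroup Lˣ).map (Herbrand.norm (L ≃ₐ[K] L))) with hy
  set u := (unitsE L ⊓ (⊤ : Subgroup Lˣ).map (Herbrand.norm (L ≃ₐ[K] L))).relIndex
      (unitsE L ⊓ (unitsIncl K L).range) with hu
  have hE1 : c = x * h1 σ (principals L) ⊥ := card_fixed_eq_relIndex_mul_h1 hσ
  have hE4 : h1 σ (principals L) ⊥ = y := h1_principals_eq_relIndex hσ
  have hE0 : h0 σ (unitsE L) ⊥ = y * u := h0_unitsE_eq_relIndex_mul hσ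
  have hunits := (card_mul_h0_unitsE_eq (F := K) (E := L) hσ).1
  rw [← Nat.card_eq_fintype_card, IsGalois.card_aut_eq_finrank, hE0] at hunits
  -- `hunits : [L:K] * (y * u) = archFactor K L * h1 σ (unitsE L) ⊥`
  rw [relIndex_map_principals_z0_top_eq hσ]
  calc c * Module.finrank K L * u
      = x * (Module.finrank K L * (y * u)) := by rw [hE1, hE4]; ring
    _ = x * (ArchHerbrand.archFactor K L * h1 σ (unitsE L) ⊥) := by rw [hunits]
    _ = ArchHerbrand.archFactor K L * (h1 σ (unitsE L) ⊥ * x) := by ring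

/-- The unit index `[E_K : E_K ∩ N_{L/K} Lˣ]` of Chevalley's formula is finite (non-zero): it
divides `#Ĥ⁰(G, 𝓞_Lˣ) ≠ 0`. [cite: Lang1990, Ch. 13 §4, Lemma 4.1 (PDF p. 204)] -/
theorem relIndex_unitsNorm_ne_zero [IsGalois K L] {σ : L ≃ₐ[K] L}
    (hσ : ∀ τ : L ≃ₐ[K] L, τ ∈ Subgroup.zpowers σ) :
    (unitsE L ⊓ (⊤ : Subgroup Lˣ).map (Herbrand.norm (L ≃ₐ[K] L))).relIndex
        (unitsE L ⊓ (unitsIncl K L).range) ≠ 0 ∧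
      ((unitsE L).map (Herbrand.norm (L ≃ₐ[K] L))).relIndex
        (unitsE L ⊓ (⊤ : Subgroup Lˣ).map (Herbrand.norm (L ≃ₐ[K] L))) ≠ 0 := by
  obtain ⟨hunits, h1ne⟩ := card_mul_h0_unitsE_eq (F := K) (E := L) hσ
  have h0ne : h0 σ (unitsE L) ⊥ ≠ 0 := fun h0 => by
    rw [h0, mul_zero] at hunits
    exact mul_ne_zero ArchHerbrand.archFactor_ne_zero h1ne hunits.symm
  rw [h0_unitsE_eq_relIndex_mul hσ] at h0ne
  exact ⟨right_ne_zero_of_mul h0ne, left_ne_zero_of_mul h0ne⟩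

end Literature.NumberTheory.NumberFields.AmbiguousClass

end
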